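import Mathlib
import Summits.Ventures.PercRepro2.Defs
import Summits.Ventures.PercRepro2.Independence
import Summits.Ventures.PercRepro2.Harris
import Summits.Ventures.PercRepro2.Graph
import Summits.Ventures.PercRepro2.Exploration
import Summits.Ventures.PercRepro2.Events
import Summits.Ventures.PercRepro2.FourFunctions
import Summits.Ventures.PercRepro2.Induced
import Summits.Ventures.PercRepro2.Frontier
import Summits.Ventures.PercRepro2.ObsIndependence
import Summits.Ventures.PercRepro2.BHK
import Summits.Ventures.PercRepro2.BHKEvents
import Summits.Ventures.PercRepro2.OrderPreservation
import Summits.Ventures.PercRepro2.OrderPreservationDual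
import Summits.Ventures.PercRepro2.VdBKahn
import Summits.Ventures.PercRepro2.BHKAvoid
import Summits.Ventures.PercRepro2.R2PrimeThreeReduction
import Summits.Ventures.PercRepro2.YBridge
import Summits.Ventures.PercRepro2.Yu1Functionals
import Summits.Ventures.PercRepro2.Yu1Events
import Summits.Ventures.PercRepro2.Yu1
import Summits.Ventures.PercRepro2.LBSplit
import Summits.Ventures.PercRepro2.YDelta
import Summits.Ventures.PercRepro2.YDeltaTools
import Summits.Ventures.PercRepro2.SD
import Summits.Ventures.PercRepro2.Threshold
import Summits.Ventures.PercRepro2.Lambda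
import Summits.Ventures.PercRepro2.LambdaTau
import Summits.Ventures.PercRepro2.LambdaSlack
import Summits.Ventures.PercRepro2.HF2
import Summits.Ventures.PercRepro2.Yu2
import Summits.Ventures.PercRepro2.N0
import Summits.Ventures.PercRepro2.Y
import Summits.Ventures.PercRepro2.ZDelta
import Summits.Ventures.PercRepro2.ZExpand
import Summits.Ventures.PercRepro2.RGapShare

/-!
# The L1 rung `Z_h ≥ 0` as a two-copy statement about the heavy cluster (blind cell PercRepro2,
p1 g5; `proofs/P1-L1TWOCOPY.md`, record row 2′Zh)

Vocabulary of `ZExpand` (`a₁` light, `a₂` heavy, `a₃`, `o`, `b`; `R = avoidAll a₁ {a₂, a₃}`,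
`Q = avoidAll a₂ {a₁}`, `PD`, `T = {a₁ ∉ C₂, a₃ ∈ C₂}`, `Δ_T = deltaT`):
`Z_h = D_o · Δ_T − P(PD) · [P(T, o ∈ C₁, b ∈ C₂) − P(T, o ∈ C₁, b ∈ C₁)]`, `D_o = P(PD, o ∈ C₁ ∪ C₂)`.

Heavy-first exploration: for the heavy cluster `U = C₂` write `f_o(U) = P_{G∖U}(o ∈ C₁)`,
`f_b(U) = P_{G∖U}(b ∈ C₁)` (`delClusterProb`).  The **two-copy T-mass**
`T₂ = E[1_{a₃ ∈ U} · f_o(U) · f_b(U); Q]` is the probability that, given `U`, `o` lies in the light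
cluster of one independent copy of `G ∖ U` and `b` in the light cluster of another.

* **`light_share_le`** (THEOREM, one cross-BHK + one PA step): for every up-set `𝓥` of heavy
  clusters, `P(PD) · P(o ∈ C₁, C₂ ∈ 𝓥, R) ≤ P(PD, o ∈ C₁) · P(C₂ ∈ 𝓥, R)` — the light share of
  `o` on any heavy-increasing `R`-event is at most its PD-share `g_l`.  Instances
  `T_share_bH_le` (`𝓥 = {a₃, b ∈ ·}`: `P(o ∈ C₁ | T, b ∈ C₂) ≤ g_l`) and `T_share_le`
  (`𝓥 = {a₃ ∈ ·}`: `P(o ∈ C₁ | T) ≤ g_l`).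
* `delClusterProb_mul_le_inter`: Harris in `G ∖ W` for two up-sets, `f_o f_b ≤ f_{ob}`.
* `tower_T_ob`: `P(T, o ∈ C₁, b ∈ C₁) = E[1_{a₃ ∈ C₂} f_{ob}(C₂); Q]` (heavy-first tower).
* **`ZhTwoCopy`** (row (C1), exact census 0 / 2,300 labelled instances `n ≤ 7`, all palettes, incl.
  the canonical NEG-32 witness): `P(PD) · [P(T, o ∈ C₁, b ∈ C₂) − T₂] ≤ D_o · Δ_T`, i.e.
  `E[1_{a₃∈U} (g − f_o(U)) (1_{b ∈ U} − f_b(U)); Q] ≥ 0` with `g = D_o / P(PD)`: "the two-copy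
  `o`-share of the T-margin is at most `g`".  OPEN.
* **`ZhNonneg_of_ZhTwoCopy`**: `ZhTwoCopy → Z_h ≥ 0` (Harris in `G ∖ U` and the tower identity).
-/

namespace Summit.Ventures.PercRepro2

open UnionCluster Yu1

section ShareTheorem

variable {V : Type*} {E : Type*} [Fintype E] [DecidableEq E] [Fintype V] [DecidableEq V]
  {R : Type*} [Field R] [LinearOrder R] [IsStrictOrderedRing R]

/-- **The light-share theorem**: for every up-set `𝓥` of heavy clusters,
`P(PD) · P(o ∈ C₁, C₂ ∈ 𝓥, R) ≤ P(PD, o ∈ C₁) · P(C₂ ∈ 𝓥, R)` (cross-cluster BHK under the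
avoidance `R` for `1_o` and `𝓥`, then positive association of `1_o` and `u` on `R`). -/
theorem light_share_le (p : E → R) (hp : IsProbVec p) (ends : E → Sym2 V) (o a₁ a₂ a₃ : V)
    {𝓥 : Set (Set V)} (h𝓥 : IsUpperSet 𝓥) :
    prob p (PDEvent ends a₁ a₂ a₃) *
        prob p (connEvent ends a₁ o ∩ clusterInEvent ends a₂ 𝓥 ∩ avoidAll ends a₁ {a₂, a₃}) ≤
      prob p (PDEvent ends a₁ a₂ a₃ ∩ connEvent ends a₁ o) *
        prob p (clusterInEvent ends a₂ 𝓥 ∩ avoidAll ends a₁ {a₂, a₃}) := by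
  have hc := bhk_cross_cluster_avoid p hp ends a₁ a₂ (X := {a₂, a₃})
    (Finset.mem_insert_self a₂ {a₃}) (isUpperSet_mem_setOf o) h𝓥
  rw [← connEvent_eq_clusterInEvent] at hc
  have hpa := oR_mul_PD_le p hp ends o a₁ a₂ a₃
  have hD : 0 ≤ prob p (PDEvent ends a₁ a₂ a₃) := prob_nonneg hp _
  have hV : 0 ≤ prob p (clusterInEvent ends a₂ 𝓥 ∩ avoidAll ends a₁ {a₂, a₃}) := prob_nonneg hp _
  rcases (prob_nonneg hp (avoidAll ends a₁ {a₂, a₃})).lt_or_eq with hpos | hzero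
  · refine le_of_mul_le_mul_right ?_ hpos
    calc prob p (PDEvent ends a₁ a₂ a₃) *
          prob p (connEvent ends a₁ o ∩ clusterInEvent ends a₂ 𝓥 ∩ avoidAll ends a₁ {a₂, a₃}) *
          prob p (avoidAll ends a₁ {a₂, a₃})
        = prob p (PDEvent ends a₁ a₂ a₃) *
          (prob p (connEvent ends a₁ o ∩ clusterInEvent ends a₂ 𝓥 ∩ avoidAll ends a₁ {a₂, a₃}) *
            prob p (avoidAll ends a₁ {a₂, a₃})) := by ring
      _ ≤ prob p (PDEvent ends a₁ a₂ a₃) *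
          (prob p (connEvent ends a₁ o ∩ avoidAll ends a₁ {a₂, a₃}) *
            prob p (clusterInEvent ends a₂ 𝓥 ∩ avoidAll ends a₁ {a₂, a₃})) :=
          mul_le_mul_of_nonneg_left hc hD
      _ = (prob p (connEvent ends a₁ o ∩ avoidAll ends a₁ {a₂, a₃}) *
            prob p (PDEvent ends a₁ a₂ a₃)) *
          prob p (clusterInEvent ends a₂ 𝓥 ∩ avoidAll ends a₁ {a₂, a₃}) := by ring
      _ ≤ (prob p (PDEvent ends a₁ a₂ a₃ ∩ connEvent ends a₁ o) *
            prob p (avoidAll ends a₁ {a₂, a₃})) *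
          prob p (clusterInEvent ends a₂ 𝓥 ∩ avoidAll ends a₁ {a₂, a₃}) :=
          mul_le_mul_of_nonneg_right hpa hV
      _ = prob p (PDEvent ends a₁ a₂ a₃ ∩ connEvent ends a₁ o) *
          prob p (clusterInEvent ends a₂ 𝓥 ∩ avoidAll ends a₁ {a₂, a₃}) *
          prob p (avoidAll ends a₁ {a₂, a₃}) := by ring
  · -- `P(R) = 0`: the left event lies inside `R`
    have h0 : prob p (connEvent ends a₁ o ∩ clusterInEvent ends a₂ 𝓥 ∩
        avoidAll ends a₁ {a₂, a₃}) = 0 :=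
      le_antisymm (hzero ▸ prob_mono hp Set.inter_subset_right) (prob_nonneg hp _)
    rw [h0, mul_zero]
    exact mul_nonneg (prob_nonneg hp _) hV

omit [Fintype E] [DecidableEq E] [Fintype V] in
/-- `T ∩ {o ∈ C₁} ∩ {b ∈ C₂} = {o ∈ C₁} ∩ {C₂ ∈ {a₃ ∈ ·} ∩ {b ∈ ·}} ∩ R`. -/
lemma T_oS_bH_eq (ends : E → Sym2 V) (o a₁ a₂ a₃ b : V) :
    TEvent ends a₁ a₂ a₃ ∩ connEvent ends a₁ o ∩ connEvent ends a₂ b =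
      connEvent ends a₁ o ∩ clusterInEvent ends a₂ ({W | a₃ ∈ W} ∩ {W | b ∈ W}) ∩
        avoidAll ends a₁ {a₂, a₃} := by
  ext ω
  simp only [TEvent, clusterInEvent, cluster, Set.mem_inter_iff, Set.mem_compl_iff,
    mem_connEvent, Set.mem_setOf_eq, mem_avoidAll, Finset.mem_insert, Finset.mem_singleton,
    forall_eq_or_imp, forall_eq]
  constructor
  · rintro ⟨⟨⟨h21, h23⟩, h1o⟩, h2b⟩
    refine ⟨⟨h1o, h23, h2b⟩, fun h12 => h21 (conn_symm h12), fun h13 => h21 ?_⟩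
    exact conn_trans h23 (conn_symm h13)
  · rintro ⟨⟨h1o, h23, h2b⟩, h12, _⟩
    exact ⟨⟨⟨fun h21 => h12 (conn_symm h21), h23⟩, h1o⟩, h2b⟩

omit [Fintype E] [DecidableEq E] [Fintype V] in
/-- `T ∩ {b ∈ C₂} = {C₂ ∈ {a₃ ∈ ·} ∩ {b ∈ ·}} ∩ R`. -/
lemma T_bH_eq (ends : E → Sym2 V) (a₁ a₂ a₃ b : V) :
    TEvent ends a₁ a₂ a₃ ∩ connEvent ends a₂ b =
      clusterInEvent ends a₂ ({W | a₃ ∈ W} ∩ {W | b ∈ W}) ∩ avoidAll ends a₁ {a₂, a₃} := by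
  ext ω
  simp only [TEvent, clusterInEvent, cluster, Set.mem_inter_iff, Set.mem_compl_iff,
    mem_connEvent, Set.mem_setOf_eq, mem_avoidAll, Finset.mem_insert, Finset.mem_singleton,
    forall_eq_or_imp, forall_eq]
  constructor
  · rintro ⟨⟨h21, h23⟩, h2b⟩
    exact ⟨⟨h23, h2b⟩, fun h12 => h21 (conn_symm h12), fun h13 => h21 (conn_trans h23 (conn_symm h13))⟩
  · rintro ⟨⟨h23, h2b⟩, h12, _⟩
    exact ⟨⟨fun h21 => h12 (conn_symm h21), h23⟩, h2b⟩

omit [Fintype E] [DecidableEq E] [Fintype V] in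
/-- `T ∩ {o ∈ C₁} = {o ∈ C₁} ∩ {C₂ ∈ {a₃ ∈ ·}} ∩ R`. -/
lemma T_oS_eq (ends : E → Sym2 V) (o a₁ a₂ a₃ : V) :
    TEvent ends a₁ a₂ a₃ ∩ connEvent ends a₁ o =
      connEvent ends a₁ o ∩ clusterInEvent ends a₂ {W | a₃ ∈ W} ∩ avoidAll ends a₁ {a₂, a₃} := by
  ext ω
  simp only [TEvent, clusterInEvent, cluster, Set.mem_inter_iff, Set.mem_compl_iff,
    mem_connEvent, Set.mem_setOf_eq, mem_avoidAll, Finset.mem_insert, Finset.mem_singleton,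
    forall_eq_or_imp, forall_eq]
  constructor
  · rintro ⟨⟨h21, h23⟩, h1o⟩
    exact ⟨⟨h1o, h23⟩, fun h12 => h21 (conn_symm h12), fun h13 => h21 (conn_trans h23 (conn_symm h13))⟩
  · rintro ⟨⟨h1o, h23⟩, h12, _⟩
    exact ⟨⟨fun h21 => h12 (conn_symm h21), h23⟩, h1o⟩

omit [Fintype E] [DecidableEq E] [Fintype V] in
/-- `T = {C₂ ∈ {a₃ ∈ ·}} ∩ R`. -/
lemma T_eq (ends : E → Sym2 V) (a₁ a₂ a₃ : V) :
    TEvent ends a₁ a₂ a₃ =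
      clusterInEvent ends a₂ {W | a₃ ∈ W} ∩ avoidAll ends a₁ {a₂, a₃} := by
  ext ω
  simp only [TEvent, clusterInEvent, cluster, Set.mem_inter_iff, Set.mem_compl_iff,
    mem_connEvent, Set.mem_setOf_eq, mem_avoidAll, Finset.mem_insert, Finset.mem_singleton,
    forall_eq_or_imp, forall_eq]
  constructor
  · rintro ⟨h21, h23⟩
    exact ⟨h23, fun h12 => h21 (conn_symm h12), fun h13 => h21 (conn_trans h23 (conn_symm h13))⟩
  · rintro ⟨h23, h12, _⟩
    exact ⟨fun h21 => h12 (conn_symm h21), h23⟩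

/-- **`P(o ∈ C₁ | T, b ∈ C₂) ≤ g_l`** (cleared): `P(PD) · P(T, o ∈ C₁, b ∈ C₂) ≤ P(PD, o ∈ C₁) · P(T, b ∈ C₂)`. -/
theorem T_share_bH_le (p : E → R) (hp : IsProbVec p) (ends : E → Sym2 V) (o a₁ a₂ a₃ b : V) :
    prob p (PDEvent ends a₁ a₂ a₃) *
        prob p (TEvent ends a₁ a₂ a₃ ∩ connEvent ends a₁ o ∩ connEvent ends a₂ b) ≤
      prob p (PDEvent ends a₁ a₂ a₃ ∩ connEvent ends a₁ o) *
        prob p (TEvent ends a₁ a₂ a₃ ∩ connEvent ends a₂ b) := by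
  rw [T_oS_bH_eq, T_bH_eq]
  exact light_share_le p hp ends o a₁ a₂ a₃
    ((isUpperSet_mem_setOf a₃).inter (isUpperSet_mem_setOf b))

/-- **`P(o ∈ C₁ | T) ≤ g_l`** (cleared): `P(PD) · P(T, o ∈ C₁) ≤ P(PD, o ∈ C₁) · P(T)`. -/
theorem T_share_le (p : E → R) (hp : IsProbVec p) (ends : E → Sym2 V) (o a₁ a₂ a₃ : V) :
    prob p (PDEvent ends a₁ a₂ a₃) * prob p (TEvent ends a₁ a₂ a₃ ∩ connEvent ends a₁ o) ≤
      prob p (PDEvent ends a₁ a₂ a₃ ∩ connEvent ends a₁ o) * prob p (TEvent ends a₁ a₂ a₃) := by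
  rw [T_oS_eq, T_eq]
  exact light_share_le p hp ends o a₁ a₂ a₃ (isUpperSet_mem_setOf a₃)

end ShareTheorem

section TwoCopy

variable {V : Type*} {E : Type*} [Fintype E] [DecidableEq E] [Fintype V] [DecidableEq V]
  {R : Type*} [Field R] [LinearOrder R] [IsStrictOrderedRing R]

omit [Fintype V] [DecidableEq V] in
/-- **Harris in `G ∖ W`** for two up-sets: `P_{G∖W}(C_t ∈ 𝓤) · P_{G∖W}(C_t ∈ 𝓥) ≤ P_{G∖W}(C_t ∈ 𝓤 ∩ 𝓥)`. -/
lemma delClusterProb_mul_le_inter (p : E → R) (hp : IsProbVec p) (ends : E → Sym2 V) (t : V)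
    {𝓤 𝓥 : Set (Set V)} (h𝓤 : IsUpperSet 𝓤) (h𝓥 : IsUpperSet 𝓥) (W : Set V) :
    delClusterProb p ends t 𝓤 W * delClusterProb p ends t 𝓥 W ≤
      delClusterProb p ends t (𝓤 ∩ 𝓥) W := by
  unfold delClusterProb
  have hA : IsUpperSet {ω : Config E | cluster ends (delConfig ends W ω) t ∈ 𝓤} :=
    fun ω ω' h hω => h𝓤 (cluster_mono (delConfig_mono W h) t) hω
  have hB : IsUpperSet {ω : Config E | cluster ends (delConfig ends W ω) t ∈ 𝓥} :=
    fun ω ω' h hω => h𝓥 (cluster_mono (delConfig_mono W h) t) hω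
  have h := prob_mul_prob_le_prob_inter hp hA hB
  refine h.trans (le_of_eq ?_)
  congr 1

/-- The **two-copy T-mass** `T₂ = E[1_{a₃ ∈ C₂} · f_o(C₂) · f_b(C₂); Q]`, `f_x(U) = P_{G∖U}(x ∈ C₁)`. -/
noncomputable def twoCopyT (p : E → R) (ends : E → Sym2 V) (o a₁ a₂ a₃ b : V) : R :=
  expect p (fun ω => ({W : Set V | a₃ ∈ W}).indicator 1 (cluster ends ω a₂) *
    (delClusterProb p ends a₁ {W | o ∈ W} (cluster ends ω a₂) *
      delClusterProb p ends a₁ {W | b ∈ W} (cluster ends ω a₂)) *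
    (avoidAll ends a₂ {a₁}).indicator 1 ω)

omit [DecidableEq V] [LinearOrder R] [IsStrictOrderedRing R] in
/-- Heavy-first tower identity: `P(T, o ∈ C₁, b ∈ C₁) = E[1_{a₃ ∈ C₂} · f_{ob}(C₂); Q]`. -/
lemma tower_T_ob (p : E → R) (ends : E → Sym2 V) (o a₁ a₂ a₃ b : V) :
    prob p (TEvent ends a₁ a₂ a₃ ∩ connEvent ends a₁ o ∩ connEvent ends a₁ b) =
      expect p (fun ω => ({W : Set V | a₃ ∈ W}).indicator 1 (cluster ends ω a₂) *
        delClusterProb p ends a₁ ({W | o ∈ W} ∩ {W | b ∈ W}) (cluster ends ω a₂) *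
        (avoidAll ends a₂ {a₁}).indicator 1 ω) := by
  have e : TEvent ends a₁ a₂ a₃ ∩ connEvent ends a₁ o ∩ connEvent ends a₁ b =
      clusterInEvent ends a₂ {W | a₃ ∈ W} ∩ clusterInEvent ends a₁ ({W | o ∈ W} ∩ {W | b ∈ W}) ∩
        avoidAll ends a₂ {a₁} := by
    ext ω
    simp only [TEvent, clusterInEvent, cluster, Set.mem_inter_iff, Set.mem_compl_iff,
      mem_connEvent, Set.mem_setOf_eq, mem_avoidAll, Finset.mem_singleton, forall_eq]
    tauto
  rw [e, prob_clusterIn_inter_avoid_eq_expect p ends a₂ a₁ (X := {a₁})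
    (Finset.mem_singleton_self a₁)]

/-- **(C1), row 2′Zh-2copy**: `P(PD) · [P(T, o ∈ C₁, b ∈ C₂) − T₂] ≤ D_o · Δ_T` — the two-copy
`o`-share of the T-margin is at most `g = P(o ∈ C₁ ∪ C₂ | PD)`.  Exact census: 0 / 2,300 labelled
instances (`n ≤ 7`, all palettes, incl. the canonical NEG-32 witness).  OPEN. -/
def ZhTwoCopy (p : E → R) (ends : E → Sym2 V) (o a₁ a₂ a₃ b : V) : Prop :=
  prob p (PDEvent ends a₁ a₂ a₃) *
      (prob p (TEvent ends a₁ a₂ a₃ ∩ connEvent ends a₁ o ∩ connEvent ends a₂ b) -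
        twoCopyT p ends o a₁ a₂ a₃ b) ≤
    (prob p (PDEvent ends a₁ a₂ a₃ ∩ connEvent ends a₁ o) +
        prob p (PDEvent ends a₁ a₂ a₃ ∩ connEvent ends a₂ o)) *
      deltaT p ends a₁ a₂ a₃ b

omit [DecidableEq V] in
/-- `T₂ ≤ P(T, o ∈ C₁, b ∈ C₁)` (Harris in `G ∖ U`, then the tower identity). -/
lemma twoCopyT_le (p : E → R) (hp : IsProbVec p) (ends : E → Sym2 V) (o a₁ a₂ a₃ b : V) :
    twoCopyT p ends o a₁ a₂ a₃ b ≤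
      prob p (TEvent ends a₁ a₂ a₃ ∩ connEvent ends a₁ o ∩ connEvent ends a₁ b) := by
  rw [tower_T_ob]
  unfold twoCopyT
  refine expect_mono hp fun ω => ?_
  refine mul_le_mul_of_nonneg_right ?_ (Set.indicator_apply_nonneg fun _ => zero_le_one)
  refine mul_le_mul_of_nonneg_left ?_ (Set.indicator_apply_nonneg fun _ => zero_le_one)
  exact delClusterProb_mul_le_inter p hp ends a₁ (isUpperSet_mem_setOf o) (isUpperSet_mem_setOf b) _

omit [DecidableEq V] in
/-- **The L1 rung from (C1)**: `ZhTwoCopy → Z_h ≥ 0`. -/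
theorem ZhNonneg_of_ZhTwoCopy (p : E → R) (hp : IsProbVec p) (ends : E → Sym2 V)
    {o a₁ a₂ a₃ b : V} (h : ZhTwoCopy p ends o a₁ a₂ a₃ b) : ZhNonneg p ends o a₁ a₂ a₃ b := by
  unfold ZhNonneg Zh
  unfold ZhTwoCopy at h
  have ht := twoCopyT_le p hp ends o a₁ a₂ a₃ b
  have hD : 0 ≤ prob p (PDEvent ends a₁ a₂ a₃) := prob_nonneg hp _
  nlinarith [mul_le_mul_of_nonneg_left ht hD]

end TwoCopy

end Summit.Ventures.PercRepro2
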